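import Literature.Computability.Complexity.XRayMachineIdx
import Literature.Computability.Complexity.UnaryBricks
import HarnessLib

/-!
# The reduction `1-IN-3-SAT → 2D-X-RAY` on codes, II: the list of incidences of the ladder complex

Second machine file for `GGP1999_circuitBoard`. On a CNF code `w = encode φ` with three literals
per clause (`m` clauses, `n = 3m` variable slots after the first-occurrence renaming of
`OneInThreeSATRename.lean`), this file computes in polynomial time the **list of all incidences**
of the ladder complex `T n (rename φ)` (`OneInThreeSATLadder.lean`), each incidence `(s, u, i)`
coded in unary as the record `⟨1ˢ, ⟨1ᵘ, 1ⁱ⟩⟩` (`encInc`):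

* on the piece argument `⟨w, 1ᵗ⟩` of an indexed fold (`Brick.foldLoop`) with `i = t / m`,
  `c = t mod m`: the numbers `m`, `n`, `2n + 2` in unary, the literal `litOf i` (`vF`, `bF`), the
  clause code `a_c` (`clsF`), the membership tests "`litOf i ∈ (rename φ)[c]`" /
  "`¬litOf i ∈ (rename φ)[c]`" (`memF`, three first-occurrence folds and polarity comparisons),
  the kind `ekind` (`ekindF`), the rows `prow`, `erow` and the four coded incidences `P, E, O, R`
  of index `i` at stage `c` (`pieceF`, value `pieceF_arg`);
* **`tcodeF`**: the concatenation fold of the (quadratically clipped) pieces over `t < 2n·m`,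
  membership in `FP` (`tcodeF_mem_FP`) and value **`tcodeF_encode : tcodeF (encode φ) = encList
  (allItems φ)`**, where `allItems φ` lists the coded incidences and **`mem_allItems_iff`**:
  `x ∈ allItems φ ↔ ∃ t ∈ T n (rename φ), x = encInc t`.

## References

* [AroraBarak2009] S. Arora, B. Barak, *Computational Complexity*, CUP 2009, §1.3.
* [GardnerGritzmannPrangenberg1999] R. J. Gardner, P. Gritzmann, D. Prangenberg, Discrete Math.
  202 (1999) 45–71, Lemma 3.4.
-/

noncomputable section

namespace Literature.Computability.Complexity

namespace OneInThree

open _root_.Computability Polynomial Brick Ladder3 Plumb HashBricks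
open scoped Notation

/-! ### Coded incidences -/

/-- The unary code `⟨1ˢ, ⟨1ᵘ, 1ⁱ⟩⟩` of an incidence. [folklore] -/
def encInc (t : Literature.Combinatorics.Enumerative.Tomography.Inc) : List Bool :=
  boolPair (ones t.1) (boolPair (ones t.2.1) (ones t.2.2))

/-- `encInc` is injective. [folklore] -/
theorem encInc_injective : Function.Injective encInc := by
  rintro ⟨s, u, i⟩ ⟨s', u', i'⟩ h
  simp only [encInc] at h
  have h1 := congrArg fstF h
  have h2 := congrArg (fun z => fstF (sndF z)) h
  have h3 := congrArg (fun z => sndF (sndF z)) h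
  simp only [fstF_boolPair, sndF_boolPair] at h1 h2 h3
  have e1 := congrArg List.length h1
  have e2 := congrArg List.length h2
  have e3 := congrArg List.length h3
  simp only [List.length_replicate] at e1 e2 e3
  rw [e1, e2, e3]

/-- Length of a coded incidence. [folklore] -/
theorem length_encInc (t : Literature.Combinatorics.Enumerative.Tomography.Inc) :
    (encInc t).length = 2 * t.1 + 2 * t.2.1 + t.2.2 + 4 := by
  simp [encInc]; omega

/-! ### The piece argument `⟨w, 1ᵗ⟩`: numbers -/

/-- `w`. [folklore] -/
def wF : List Bool → List Bool := fstF
/-- `1ᵗ`. [folklore] -/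
def tF : List Bool → List Bool := sndF
/-- `1ᵐ` (the unary header of `w`). [folklore] -/
def mF : List Bool → List Bool := fstF ∘ fstF
/-- `⟨1^{t / m}, 1^{t mod m}⟩`. [folklore] -/
def icF : List Bool → List Bool := divModFn ∘ fanoutFn mF tF
/-- `1ⁱ`, `i = t / m`. [folklore] -/
def iF : List Bool → List Bool := fstF ∘ icF
/-- `1ᶜ`, `c = t mod m`. [folklore] -/
def cF : List Bool → List Bool := sndF ∘ icF
/-- `1ⁿ`, `n = 3m`. [folklore] -/
def nF : List Bool → List Bool := appendFn ∘ fanoutFn mF (appendFn ∘ fanoutFn mF mF)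
/-- `1^{2n+2}` (index modulus = row modulus). [folklore] -/
def a2F : List Bool → List Bool := appendFn ∘ fanoutFn nF (appendFn ∘ fanoutFn nF (fun _ => ones 2))
/-- `1^{i/2}` (the variable of `litOf i`). [folklore] -/
def vF : List Bool → List Bool := halfFn ∘ iF
/-- `[i even]` (the polarity of `litOf i`), one-bit. [folklore] -/
def bF : List Bool → List Bool := isNilFn ∘ modLenFn ∘ fanoutFn (fun _ => ones 2) iF
/-- `1^{2 + 2 (i/2)}`. [folklore] -/
def twovF : List Bool → List Bool := appendFn ∘ fanoutFn (fun _ => ones 2) (appendFn ∘ fanoutFn vF vF)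
/-- The clause code `a_c`. [folklore] -/
def clsF : List Bool → List Bool := nthItemFn ∘ fanoutFn cF (sndF ∘ wF)
/-- `1^{(c+1) mod m}`. [folklore] -/
def nxtF : List Bool → List Bool := modLenFn ∘ fanoutFn mF (List.cons true ∘ cF)

/-! ### The piece argument: membership tests, kind, rows, the piece -/

/-- "Literal `j` of `a_c`, renamed, is `(i/2, pol)`" (one-bit): first occurrence of its numeral
`= i/2` and polarity `= pol`. [folklore] -/
def litMatchF (j : ℕ) (pol : List Bool → List Bool) : List Bool → List Bool :=
  andFn (eqPairFn ∘ fanoutFn (firstOccF ∘ fanoutFn wF (varF j ∘ clsF)) vF)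
    (eqPairFn ∘ fanoutFn (pltF j ∘ clsF) pol)

/-- "`(i/2, pol) ∈ (rename φ)[c]`" (one-bit). [folklore] -/
def memF (pol : List Bool → List Bool) : List Bool → List Bool :=
  orFn (litMatchF 0 pol) (orFn (litMatchF 1 pol) (litMatchF 2 pol))

/-- `1^{ekind}`: `0` if `litOf i ∈ C_c`, `1` if only its negation, `3 + 2(i/2)` else. [folklore] -/
def ekindF : List Bool → List Bool :=
  iteFn (memF bF) (fun _ => []) (iteFn (memF (notFn bF)) (fun _ => [true])
    (appendFn ∘ fanoutFn (fun _ => ones 3) (appendFn ∘ fanoutFn vF vF)))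

/-- `1^{(2n+2) k}` for the stage `k` computed by `g`. [folklore] -/
def rowBaseF (g : List Bool → List Bool) : List Bool → List Bool := umulFn ∘ fanoutFn a2F g

/-- `1^{prow n i c}`. [folklore] -/
def prowF : List Bool → List Bool := appendFn ∘ fanoutFn (rowBaseF cF) twovF
/-- `1^{erow n φ' i c}`. [folklore] -/
def erowF : List Bool → List Bool := appendFn ∘ fanoutFn (rowBaseF cF) ekindF
/-- `1^{prow n i (nxt c)}`. [folklore] -/
def prowNF : List Bool → List Bool := appendFn ∘ fanoutFn (rowBaseF nxtF) twovF
/-- `1^{2c}`. [folklore] -/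
def colLF : List Bool → List Bool := appendFn ∘ fanoutFn cF cF
/-- `1^{2c+1}`. [folklore] -/
def colRF : List Bool → List Bool := List.cons true ∘ colLF

/-- The record `⟨s, ⟨u, i⟩⟩` of three computed fields. [folklore] -/
def encF (s u i : List Bool → List Bool) : List Bool → List Bool := fanoutFn s (fanoutFn u i)

/-- **The piece**: the framed codes of the incidences `P, E, O, R` of index `i = t/m` at stage
`c = t mod m`. [folklore] -/
def pieceF : List Bool → List Bool :=
  appendFn ∘ fanoutFn (frameF (encF colLF prowF iF))
    (appendFn ∘ fanoutFn (frameF (encF colLF erowF iF))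
      (appendFn ∘ fanoutFn (frameF (encF colRF erowF iF)) (frameF (encF colRF prowNF iF))))

/-! ### Membership in `FP` -/

/-- `mF`: membership in `FP` by composition. [cite: AroraBarak2009, §1.3] -/
theorem mF_mem_FP : mF ∈ FP := comp_mem_FP fstF_mem_FP fstF_mem_FP
/-- `icF`: membership in `FP` by composition. [cite: AroraBarak2009, §1.3] -/
theorem icF_mem_FP : icF ∈ FP := comp_mem_FP divModFn_mem_FP (fanoutFn_mem_FP mF_mem_FP sndF_mem_FP)
/-- `iF`: membership in `FP` by composition. [cite: AroraBarak2009, §1.3] -/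
theorem iF_mem_FP : iF ∈ FP := comp_mem_FP fstF_mem_FP icF_mem_FP
/-- `cF`: membership in `FP` by composition. [cite: AroraBarak2009, §1.3] -/
theorem cF_mem_FP : cF ∈ FP := comp_mem_FP sndF_mem_FP icF_mem_FP
/-- `nF`: membership in `FP` by composition. [cite: AroraBarak2009, §1.3] -/
theorem nF_mem_FP : nF ∈ FP :=
  comp_mem_FP appendFn_mem_FP (fanoutFn_mem_FP mF_mem_FP (comp_mem_FP appendFn_mem_FP
    (fanoutFn_mem_FP mF_mem_FP mF_mem_FP)))
/-- `a2F`: membership in `FP` by composition. [cite: AroraBarak2009, §1.3] -/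
theorem a2F_mem_FP : a2F ∈ FP :=
  comp_mem_FP appendFn_mem_FP (fanoutFn_mem_FP nF_mem_FP (comp_mem_FP appendFn_mem_FP
    (fanoutFn_mem_FP nF_mem_FP (const_mem_FP _))))
/-- `vF`: membership in `FP` by composition. [cite: AroraBarak2009, §1.3] -/
theorem vF_mem_FP : vF ∈ FP := comp_mem_FP halfFn_mem_FP iF_mem_FP
/-- `bF`: membership in `FP` by composition. [cite: AroraBarak2009, §1.3] -/
theorem bF_mem_FP : bF ∈ FP :=
  comp_mem_FP isNilFn_mem_FP (comp_mem_FP modLenFn_mem_FP (fanoutFn_mem_FP (const_mem_FP _) iF_mem_FP))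
/-- `twovF`: membership in `FP` by composition. [cite: AroraBarak2009, §1.3] -/
theorem twovF_mem_FP : twovF ∈ FP :=
  comp_mem_FP appendFn_mem_FP (fanoutFn_mem_FP (const_mem_FP _) (comp_mem_FP appendFn_mem_FP
    (fanoutFn_mem_FP vF_mem_FP vF_mem_FP)))
/-- `clsF`: membership in `FP` by composition. [cite: AroraBarak2009, §1.3] -/
theorem clsF_mem_FP : clsF ∈ FP :=
  comp_mem_FP nthItemFn_mem_FP (fanoutFn_mem_FP cF_mem_FP (comp_mem_FP sndF_mem_FP fstF_mem_FP))
/-- `nxtF`: membership in `FP` by composition. [cite: AroraBarak2009, §1.3] -/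
theorem nxtF_mem_FP : nxtF ∈ FP :=
  comp_mem_FP modLenFn_mem_FP (fanoutFn_mem_FP mF_mem_FP (comp_mem_FP (cons_mem_FP true) cF_mem_FP))

/-- `litMatchF`: membership in `FP` by composition. [cite: AroraBarak2009, §1.3] -/
theorem litMatchF_mem_FP (j : ℕ) {pol : List Bool → List Bool} (hp : pol ∈ FP) : litMatchF j pol ∈ FP :=
  andFn_mem_FP (comp_mem_FP eqPairFn_mem_FP (fanoutFn_mem_FP (comp_mem_FP firstOccF_mem_FP
      (fanoutFn_mem_FP fstF_mem_FP (comp_mem_FP (varF_mem_FP j) clsF_mem_FP))) vF_mem_FP))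
    (comp_mem_FP eqPairFn_mem_FP (fanoutFn_mem_FP (comp_mem_FP (pltF_mem_FP j) clsF_mem_FP) hp))

/-- `memF`: membership in `FP` by composition. [cite: AroraBarak2009, §1.3] -/
theorem memF_mem_FP {pol : List Bool → List Bool} (hp : pol ∈ FP) : memF pol ∈ FP :=
  orFn_mem_FP (litMatchF_mem_FP 0 hp) (orFn_mem_FP (litMatchF_mem_FP 1 hp) (litMatchF_mem_FP 2 hp))

/-- `ekindF`: membership in `FP` by composition. [cite: AroraBarak2009, §1.3] -/
theorem ekindF_mem_FP : ekindF ∈ FP :=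
  iteFn_mem_FP (memF_mem_FP bF_mem_FP) (const_mem_FP _) (iteFn_mem_FP (memF_mem_FP (notFn_mem_FP bF_mem_FP))
    (const_mem_FP _) (comp_mem_FP appendFn_mem_FP (fanoutFn_mem_FP (const_mem_FP _)
      (comp_mem_FP appendFn_mem_FP (fanoutFn_mem_FP vF_mem_FP vF_mem_FP)))))

/-- `rowBaseF`: membership in `FP` by composition. [cite: AroraBarak2009, §1.3] -/
theorem rowBaseF_mem_FP {g : List Bool → List Bool} (hg : g ∈ FP) : rowBaseF g ∈ FP :=
  comp_mem_FP umulFn_mem_FP (fanoutFn_mem_FP a2F_mem_FP hg)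

/-- `prowF`: membership in `FP` by composition. [cite: AroraBarak2009, §1.3] -/
theorem prowF_mem_FP : prowF ∈ FP :=
  comp_mem_FP appendFn_mem_FP (fanoutFn_mem_FP (rowBaseF_mem_FP cF_mem_FP) twovF_mem_FP)
/-- `erowF`: membership in `FP` by composition. [cite: AroraBarak2009, §1.3] -/
theorem erowF_mem_FP : erowF ∈ FP :=
  comp_mem_FP appendFn_mem_FP (fanoutFn_mem_FP (rowBaseF_mem_FP cF_mem_FP) ekindF_mem_FP)
/-- `prowNF`: membership in `FP` by composition. [cite: AroraBarak2009, §1.3] -/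
theorem prowNF_mem_FP : prowNF ∈ FP :=
  comp_mem_FP appendFn_mem_FP (fanoutFn_mem_FP (rowBaseF_mem_FP nxtF_mem_FP) twovF_mem_FP)
/-- `colLF`: membership in `FP` by composition. [cite: AroraBarak2009, §1.3] -/
theorem colLF_mem_FP : colLF ∈ FP := comp_mem_FP appendFn_mem_FP (fanoutFn_mem_FP cF_mem_FP cF_mem_FP)
/-- `colRF`: membership in `FP` by composition. [cite: AroraBarak2009, §1.3] -/
theorem colRF_mem_FP : colRF ∈ FP := comp_mem_FP (cons_mem_FP true) colLF_mem_FP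

/-- `encF`: membership in `FP` by composition. [cite: AroraBarak2009, §1.3] -/
theorem encF_mem_FP {s u i : List Bool → List Bool} (hs : s ∈ FP) (hu : u ∈ FP) (hi : i ∈ FP) :
    encF s u i ∈ FP :=
  fanoutFn_mem_FP hs (fanoutFn_mem_FP hu hi)

/-- **`pieceF ∈ FP`.** [cite: AroraBarak2009, §1.3] -/
theorem pieceF_mem_FP : pieceF ∈ FP :=
  comp_mem_FP appendFn_mem_FP (fanoutFn_mem_FP (frameF_mem_FP (encF_mem_FP colLF_mem_FP prowF_mem_FP iF_mem_FP))
    (comp_mem_FP appendFn_mem_FP (fanoutFn_mem_FP (frameF_mem_FP (encF_mem_FP colLF_mem_FP erowF_mem_FP iF_mem_FP))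
      (comp_mem_FP appendFn_mem_FP (fanoutFn_mem_FP
        (frameF_mem_FP (encF_mem_FP colRF_mem_FP erowF_mem_FP iF_mem_FP))
        (frameF_mem_FP (encF_mem_FP colRF_mem_FP prowNF_mem_FP iF_mem_FP)))))))

/-! ### Values on a genuine argument `⟨encode φ, 1ᵗ⟩` -/

section Values

variable {φ : CNF ℕ} (hφ : φ.IsThreeLiteralClauses)

/-- The genuine argument. [folklore] -/
def arg (φ : CNF ℕ) (t : ℕ) : List Bool := boolPair (encodingCNF.encode φ) (ones t)

/-- `mF` reads the unary header of the first field. [folklore] -/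
theorem mF_boolPair (φ : CNF ℕ) (z : List Bool) : mF (boolPair (encodingCNF.encode φ) z) = ones φ.length := by
  simp [mF, encodeCNF_eq]

/-- `nF` on any record with first field `encode φ`: `1^{3m}`. [folklore] -/
theorem nF_boolPair (φ : CNF ℕ) (z : List Bool) : nF (boolPair (encodingCNF.encode φ) z) = ones (3 * φ.length) := by
  simp only [nF, Function.comp_apply, fanoutFn_apply, mF_boolPair, appendFn_boolPair, ones, ← List.replicate_add]
  congr 1; omega

/-- `wF ⟨w, 1ᵗ⟩ = w`. [folklore] -/
theorem wF_arg (φ : CNF ℕ) (t : ℕ) : wF (arg φ t) = encodingCNF.encode φ := fstF_boolPair _ _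

/-- `tF ⟨w, 1ᵗ⟩ = 1ᵗ`. [folklore] -/
theorem tF_arg (φ : CNF ℕ) (t : ℕ) : tF (arg φ t) = ones t := sndF_boolPair _ _

/-- `mF ⟨w, 1ᵗ⟩ = 1ᵐ`. [folklore] -/
theorem mF_arg (φ : CNF ℕ) (t : ℕ) : mF (arg φ t) = ones φ.length := mF_boolPair φ _

/-- `iF ⟨w, 1ᵗ⟩ = 1^{t/m}`. [folklore] -/
theorem iF_arg (φ : CNF ℕ) (t : ℕ) : iF (arg φ t) = ones (t / φ.length) := by
  simp only [iF, icF, Function.comp_apply, fanoutFn_apply, mF_arg, tF_arg, divModFn_boolPair, fstF_boolPair]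

/-- `cF ⟨w, 1ᵗ⟩ = 1^{t mod m}`. [folklore] -/
theorem cF_arg (φ : CNF ℕ) (t : ℕ) : cF (arg φ t) = ones (t % φ.length) := by
  simp only [cF, icF, Function.comp_apply, fanoutFn_apply, mF_arg, tF_arg, divModFn_boolPair, sndF_boolPair]

include hφ in
/-- `nF ⟨w, 1ᵗ⟩ = 1ⁿ`. [folklore] -/
theorem nF_arg (t : ℕ) : nF (arg φ t) = ones (varList φ).length := by
  rw [arg, nF_boolPair, length_varList hφ]

include hφ in
/-- Value of `a2F` on a genuine argument. [folklore] -/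
theorem a2F_arg (t : ℕ) : a2F (arg φ t) = ones (2 * (varList φ).length + 2) := by
  simp only [a2F, Function.comp_apply, fanoutFn_apply, nF_arg hφ, appendFn_boolPair, ones, ← List.replicate_add]
  congr 1; omega

/-- Value of `vF` on a genuine argument. [folklore] -/
theorem vF_arg (φ : CNF ℕ) (t : ℕ) : vF (arg φ t) = ones (t / φ.length / 2) := by
  simp [vF, iF_arg, halfFn]

/-- Value of `bF` on a genuine argument. [folklore] -/
theorem bF_arg (φ : CNF ℕ) (t : ℕ) : bF (arg φ t) = [decide (t / φ.length % 2 = 0)] := by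
  simp only [bF, Function.comp_apply, fanoutFn_apply, iF_arg, modLenFn_boolPair, List.length_replicate, isNilFn]
  congr 1
  apply Bool.decide_congr
  constructor
  · intro h; simpa using congrArg List.length h
  · intro h; rw [h]; rfl

/-- Value of `twovF` on a genuine argument. [folklore] -/
theorem twovF_arg (φ : CNF ℕ) (t : ℕ) : twovF (arg φ t) = ones (2 + 2 * (t / φ.length / 2)) := by
  simp only [twovF, Function.comp_apply, fanoutFn_apply, vF_arg, appendFn_boolPair, ones, ← List.replicate_add]
  congr 1; omega

/-- `nthItemFn` on a unary index and a coded list. Twin of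
`Literature.Computability.Complexity.nthItemFn_encList` (`GoldwasserSipserRefereeBricks.lean`, not a
reasonable import here; a further copy sits in `GridSAWTowersPieceFn.lean`) — a librarian
consolidation candidate for `HashBricks.lean`, next to `nthItemFn_body` to which all copies reduce.
[folklore] -/
theorem nthItemFn_encList (c : ℕ) (l : List (List Bool)) :
    nthItemFn (boolPair (ones c) (encList l)) = l.getD c [] := by
  rw [nthItemFn_boolPair, List.length_replicate]
  have : ∀ (j : ℕ) (z : List Bool), fstF (sndF^[j] z) = nthF j z := by
    intro j; induction j with
    | zero => intro z; rfl
    | succ j ih => intro z; rw [Function.iterate_succ_apply, ih]; rfl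
  rw [this, nthF_encList]

/-- The clause code fetched: `a_c = encode φ[t mod m]`. [folklore] -/
theorem clsF_arg (φ : CNF ℕ) {t : ℕ} (hm : 0 < φ.length) :
    clsF (arg φ t) = encodingClause.encode (φ[t % φ.length]'(Nat.mod_lt _ hm)) := by
  rw [clsF, Function.comp_apply, fanoutFn_apply, cF_arg, Function.comp_apply, wF, arg, fstF_boolPair,
    encodeCNF_eq, sndF_boolPair, nthItemFn_encList, List.getD_eq_getElem _ _ (by simpa using Nat.mod_lt _ hm),
    List.getElem_map]

/-- Value of `nxtF` on a genuine argument. [folklore] -/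
theorem nxtF_arg (φ : CNF ℕ) (t : ℕ) : nxtF (arg φ t) = ones (nxt (rename φ) (t % φ.length)) := by
  simp only [nxtF, Function.comp_apply, fanoutFn_apply, mF_arg, cF_arg, modLenFn_boolPair, List.length_cons,
    List.length_replicate, nxt, length_rename]

include hφ in
/-- **Value of the literal match**: literal `j` of clause `c`, renamed, equals `(t/m/2, b)`.
[folklore] -/
theorem litMatchF_arg {t : ℕ} (hm : 0 < φ.length) (j : ℕ) (hj : j < 3) {pol : List Bool → List Bool}
    {b : Bool} (hpol : pol (arg φ t) = [b]) :
    litMatchF j pol (arg φ t) =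
      [decide (renameLit φ ((φ[t % φ.length]'(Nat.mod_lt _ hm))[j]'(by
        rw [(hφ _ (List.getElem_mem _)).1]; exact hj)) = (t / φ.length / 2, b))] := by
  have h3 := (hφ _ (List.getElem_mem (Nat.mod_lt t hm))).1
  have hj' : j < (φ[t % φ.length]'(Nat.mod_lt _ hm)).length := by rw [h3]; exact hj
  have h1 : (eqPairFn ∘ fanoutFn (firstOccF ∘ fanoutFn wF (varF j ∘ clsF)) vF) (arg φ t) =
      [decide (firstOcc φ ((φ[t % φ.length]'(Nat.mod_lt _ hm))[j]).1 = t / φ.length / 2)] := by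
    simp only [Function.comp_apply, fanoutFn_apply, clsF_arg φ hm, varF_encode _ hj', vF_arg, wF_arg,
      firstOccF_encode hφ, eqPairFn_boolPair]
    congr 1; exact Bool.decide_congr List.replicate_left_inj
  have h2 : (eqPairFn ∘ fanoutFn (pltF j ∘ clsF) pol) (arg φ t) =
      [decide (((φ[t % φ.length]'(Nat.mod_lt _ hm))[j]).2 = b)] := by
    simp only [Function.comp_apply, fanoutFn_apply, clsF_arg φ hm, pltF_encode _ hj', hpol, eqPairFn_boolPair,
      List.cons.injEq, and_true]
  rw [litMatchF, andFn_apply h1 h2]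
  simp only [renameLit, Prod.mk.injEq, Bool.decide_and]

include hφ in
/-- **Value of the membership test**: `[(t/m/2, b) ∈ (rename φ)[c]]`. [folklore] -/
theorem memF_arg {t : ℕ} (hm : 0 < φ.length) {pol : List Bool → List Bool} {b : Bool}
    (hpol : pol (arg φ t) = [b]) :
    memF pol (arg φ t) = [decide (((t / φ.length / 2, b) : Literal ℕ) ∈ (rename φ).getD (t % φ.length) [])] := by
  have hc : t % φ.length < φ.length := Nat.mod_lt _ hm
  have h3 := (hφ _ (List.getElem_mem hc)).1
  rw [memF, orFn_apply (litMatchF_arg hφ hm 0 (by omega) hpol) (orFn_apply (litMatchF_arg hφ hm 1 (by omega) hpol)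
    (litMatchF_arg hφ hm 2 (by omega) hpol))]
  congr 1
  rw [Bool.eq_iff_iff]
  simp only [Bool.or_eq_true, decide_eq_true_eq]
  rw [rename, List.getD_eq_getElem _ _ (by simpa using hc), List.getElem_map, List.mem_map]
  obtain ⟨l0, l1, l2, hC⟩ := List.length_eq_three.1 h3
  simp only [hC, List.getElem_cons_zero, List.getElem_cons_succ, List.mem_cons, List.not_mem_nil, or_false]
  constructor
  · rintro (h | h | h)
    · exact ⟨l0, Or.inl rfl, h⟩
    · exact ⟨l1, Or.inr (Or.inl rfl), h⟩
    · exact ⟨l2, Or.inr (Or.inr rfl), h⟩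
  · rintro ⟨ℓ, hℓ, h⟩
    rcases hℓ with rfl | rfl | rfl
    · exact Or.inl h
    · exact Or.inr (Or.inl h)
    · exact Or.inr (Or.inr h)

/-- The literal of index `i` and its negation, as pairs. [folklore] -/
theorem litOf_eq (i : ℕ) : litOf i = (i / 2, decide (i % 2 = 0)) := rfl

/-- `negate_litOf_eq` (auxiliary). [folklore] -/
theorem negate_litOf_eq (i : ℕ) : (litOf i).negate = (i / 2, !decide (i % 2 = 0)) := rfl

include hφ in
/-- **Value of the kind**: `1^{ekind (rename φ) (t/m) (t mod m)}`. [folklore] -/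
theorem ekindF_arg {t : ℕ} (hm : 0 < φ.length) :
    ekindF (arg φ t) = ones (ekind (rename φ) (t / φ.length) (t % φ.length)) := by
  have hb := bF_arg φ t
  have hnb : notFn bF (arg φ t) = [!decide (t / φ.length % 2 = 0)] := notFn_apply hb
  rw [ekindF, iteFn_apply (memF_arg hφ hm hb), ekind, negate_litOf_eq, litOf_eq]
  by_cases h1 : ((t / φ.length / 2, decide (t / φ.length % 2 = 0)) : Literal ℕ) ∈ (rename φ).getD (t % φ.length) []
  · rw [decide_eq_true h1, if_pos rfl, if_pos h1]; rfl
  · rw [decide_eq_false h1, if_neg Bool.false_ne_true, if_neg h1, iteFn_apply (memF_arg hφ hm hnb)]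
    by_cases h2 : ((t / φ.length / 2, !decide (t / φ.length % 2 = 0)) : Literal ℕ) ∈ (rename φ).getD (t % φ.length) []
    · rw [decide_eq_true h2, if_pos rfl, if_pos h2]; rfl
    · rw [decide_eq_false h2, if_neg Bool.false_ne_true, if_neg h2]
      simp only [Function.comp_apply, fanoutFn_apply, vF_arg, appendFn_boolPair, ones, ← List.replicate_add]
      congr 1; omega

include hφ in
/-- Value of `rowBaseF` on a genuine argument. [folklore] -/
theorem rowBaseF_arg {g : List Bool → List Bool} {t k : ℕ} (hg : g (arg φ t) = ones k) :
    rowBaseF g (arg φ t) = ones ((2 * (varList φ).length + 2) * k) := by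
  simp only [rowBaseF, Function.comp_apply, fanoutFn_apply, a2F_arg hφ, hg, umulFn_boolPair]

include hφ in
/-- **Value of `prowF`**: `1^{prow n (t/m) (t mod m)}`. [folklore] -/
theorem prowF_arg (t : ℕ) : prowF (arg φ t) = ones (prow (varList φ).length (t / φ.length) (t % φ.length)) := by
  simp only [prowF, Function.comp_apply, fanoutFn_apply, rowBaseF_arg hφ (cF_arg φ t), twovF_arg,
    appendFn_boolPair, prow, ones, ← List.replicate_add]

include hφ in
/-- **Value of `erowF`**: `1^{erow n (rename φ) (t/m) (t mod m)}`. [folklore] -/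
theorem erowF_arg {t : ℕ} (hm : 0 < φ.length) :
    erowF (arg φ t) = ones (erow (varList φ).length (rename φ) (t / φ.length) (t % φ.length)) := by
  simp only [erowF, Function.comp_apply, fanoutFn_apply, rowBaseF_arg hφ (cF_arg φ t), ekindF_arg hφ hm,
    appendFn_boolPair, erow, ones, ← List.replicate_add]

include hφ in
/-- **Value of `prowNF`**: `1^{prow n (t/m) (nxt (t mod m))}`. [folklore] -/
theorem prowNF_arg (t : ℕ) :
    prowNF (arg φ t) = ones (prow (varList φ).length (t / φ.length) (nxt (rename φ) (t % φ.length))) := by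
  simp only [prowNF, Function.comp_apply, fanoutFn_apply, rowBaseF_arg hφ (nxtF_arg φ t), twovF_arg,
    appendFn_boolPair, prow, ones, ← List.replicate_add]

/-- Value of `colLF` on a genuine argument. [folklore] -/
theorem colLF_arg (φ : CNF ℕ) (t : ℕ) : colLF (arg φ t) = ones (2 * (t % φ.length)) := by
  simp only [colLF, Function.comp_apply, fanoutFn_apply, cF_arg, appendFn_boolPair, ones, ← List.replicate_add]
  congr 1; omega

/-- Value of `colRF` on a genuine argument. [folklore] -/
theorem colRF_arg (φ : CNF ℕ) (t : ℕ) : colRF (arg φ t) = ones (2 * (t % φ.length) + 1) := by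
  simp only [colRF, Function.comp_apply, colLF_arg, ones, List.replicate_succ]

/-- The four coded incidences of index `i` at stage `c`. [folklore] -/
def stageItems (n : ℕ) (φ' : CNF ℕ) (i c : ℕ) : List (List Bool) :=
  [encInc (Pinc n i c), encInc (Einc n φ' i c), encInc (Oinc n φ' i c), encInc (Rinc n φ' i c)]

include hφ in
/-- **Value of the piece on a genuine argument**: the coded incidences `P, E, O, R` of index
`t / m` at stage `t mod m` of the ladder of `rename φ`. [folklore] -/
theorem pieceF_arg {t : ℕ} (hm : 0 < φ.length) :
    pieceF (arg φ t) = encList (stageItems (varList φ).length (rename φ) (t / φ.length) (t % φ.length)) := by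
  simp only [pieceF, encF, Function.comp_apply, fanoutFn_apply, frameF_apply, appendFn_boolPair, colLF_arg,
    colRF_arg, prowF_arg hφ, erowF_arg hφ hm, prowNF_arg hφ, iF_arg, stageItems, encList_cons_eq, encList_nil,
    List.append_nil, encInc, Pinc, Einc, Oinc, Rinc]

end Values

/-! ### The fold: all incidences -/

/-- The clip constant of the incidence fold. [folklore] -/
def Ct : ℕ := 300

/-- `1^{6m} = 1^{2n}` on a CNF code (six copies of the unary header). [folklore] -/
def sixF : List Bool → List Bool :=
  appendFn ∘ fanoutFn fstF (appendFn ∘ fanoutFn fstF (appendFn ∘ fanoutFn fstF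
    (appendFn ∘ fanoutFn fstF (appendFn ∘ fanoutFn fstF fstF))))

/-- `1^{2n·m}`, the number of pieces. [folklore] -/
def kF : List Bool → List Bool := umulFn ∘ fanoutFn sixF fstF

/-- The initial record `⟨w, ⟨bin (2n m), ⟨1⁰, ε⟩⟩⟩` of the fold. [folklore] -/
def tInit : List Bool → List Bool :=
  fanoutFn id (fanoutFn (lenBinF ∘ kF) (fun _ => boolPair (ones 0) []))

/-- **The incidence list of the ladder complex, on codes**: the concatenation fold of the clipped
pieces over `t < 2n·m`. [cite: GardnerGritzmannPrangenberg1999, Lemma 3.4] -/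
def tcodeF : List Bool → List Bool :=
  sndPow 2 ∘ foldLoop appF (clip2F Ct pieceF) (Polynomial.C 6 * X ^ 2) ∘ tInit

/-- `sixF ∈ FP`. [cite: AroraBarak2009, §1.3] -/
theorem sixF_mem_FP : sixF ∈ FP :=
  comp_mem_FP appendFn_mem_FP (fanoutFn_mem_FP fstF_mem_FP (comp_mem_FP appendFn_mem_FP (fanoutFn_mem_FP fstF_mem_FP
    (comp_mem_FP appendFn_mem_FP (fanoutFn_mem_FP fstF_mem_FP (comp_mem_FP appendFn_mem_FP (fanoutFn_mem_FP fstF_mem_FP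
      (comp_mem_FP appendFn_mem_FP (fanoutFn_mem_FP fstF_mem_FP fstF_mem_FP)))))))))

/-- `kF ∈ FP`. [cite: AroraBarak2009, §1.3] -/
theorem kF_mem_FP : kF ∈ FP := comp_mem_FP umulFn_mem_FP (fanoutFn_mem_FP sixF_mem_FP fstF_mem_FP)

/-- `tInit ∈ FP`. [cite: AroraBarak2009, §1.3] -/
theorem tInit_mem_FP : tInit ∈ FP :=
  fanoutFn_mem_FP (PolyTimeComputable.id _) (fanoutFn_mem_FP (comp_mem_FP lenBinF_mem_FP kF_mem_FP) (const_mem_FP _))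

/-- **`tcodeF ∈ FP`** (`foldLoop_clip2F_mem_FP`). [cite: AroraBarak2009, §1.3 (bounded loops)] -/
theorem tcodeF_mem_FP : tcodeF ∈ FP :=
  comp_mem_FP (sndPow_mem_FP 2) (comp_mem_FP
    (foldLoop_clip2F_mem_FP Ct appF_mem_FP length_appF_le pieceF_mem_FP _) tInit_mem_FP)

/-- The number of pieces on a code: `2n·m`. [folklore] -/
theorem kF_encode {φ : CNF ℕ} (hφ : φ.IsThreeLiteralClauses) :
    kF (encodingCNF.encode φ) = ones (2 * (varList φ).length * φ.length) := by
  have hf : fstF (encodingCNF.encode φ) = ones φ.length := by rw [encodeCNF_eq, fstF_boolPair]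
  have h6 : sixF (encodingCNF.encode φ) = ones (6 * φ.length) := by
    simp only [sixF, Function.comp_apply, fanoutFn_apply, hf, appendFn_boolPair, ones, ← List.replicate_add]
    congr 1; omega
  have e1 : kF (encodingCNF.encode φ) = umulFn (boolPair (sixF (encodingCNF.encode φ)) (fstF (encodingCNF.encode φ))) := by
    rw [kF, Function.comp_apply, fanoutFn_apply]
  rw [e1]
  rw [h6]
  rw [hf]
  rw [umulFn_boolPair]
  rw [length_varList hφ]
  have e2 : 6 * φ.length * φ.length = 2 * (3 * φ.length) * φ.length := by ring
  rw [e2]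

/-- All coded incidences, piece by piece. [folklore] -/
def allItems (φ : CNF ℕ) : List (List Bool) :=
  (List.range (2 * (varList φ).length * φ.length)).flatMap fun t =>
    stageItems (varList φ).length (rename φ) (t / φ.length) (t % φ.length)

/-- **Size of a genuine piece**: at most `Ct (|w| + 1)²`. [folklore] -/
theorem length_pieceF_arg {φ : CNF ℕ} (hφ : φ.IsThreeLiteralClauses) {t : ℕ}
    (ht : t < 2 * (varList φ).length * φ.length) :
    (pieceF (arg φ t)).length ≤ Ct * ((encodingCNF.encode φ).length + 1) ^ 2 := by
  have hm : 0 < φ.length := Nat.pos_of_ne_zero fun h => by rw [h] at ht; simp at ht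
  have hn := length_varList hφ
  set m := φ.length with hm_def
  have hL : m ≤ (encodingCNF.encode φ).length := by
    have := length_fstF_sndF_le (encodingCNF.encode φ)
    rw [encodeCNF_eq, fstF_boolPair, List.length_replicate] at this
    rw [encodeCNF_eq]; omega
  have hi : t / m < 2 * (varList φ).length := by
    rw [Nat.div_lt_iff_lt_mul hm]; exact ht
  have hc : t % m < m := Nat.mod_lt _ hm
  have hnx : nxt (rename φ) (t % m) < m := by rw [hm_def, ← length_rename φ]; exact nxt_lt (by rw [length_rename]; exact hc)
  have hek := ekind_lt (φ := rename φ) hi (t % m)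
  rw [pieceF_arg hφ hm, stageItems, encList_cons_eq, encList_cons_eq, encList_cons_eq, encList_cons_eq, encList_nil]
  simp only [List.append_nil, List.length_append, length_frame, length_encInc, Pinc, Einc, Oinc, Rinc, prow, erow]
  set L := (encodingCNF.encode φ).length
  have h1 : (2 * (varList φ).length + 2) * (t % m) ≤ (6 * L + 2) * L := by
    apply Nat.mul_le_mul <;> omega
  have h2 : (2 * (varList φ).length + 2) * nxt (rename φ) (t % m) ≤ (6 * L + 2) * L := by
    apply Nat.mul_le_mul <;> omega
  have h3 : t / m / 2 ≤ 3 * L := by omega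
  rw [Ct]
  nlinarith [h1, h2, h3, hek, hc, hL]

/-- The concatenated pieces are the code of `allItems`. [folklore] -/
theorem ccat_pieceF {φ : CNF ℕ} (hφ : φ.IsThreeLiteralClauses) (hm : 0 < φ.length) : ∀ K,
    ccat (fun j => pieceF (boolPair (encodingCNF.encode φ) (ones j))) K =
      encList ((List.range K).flatMap fun t => stageItems (varList φ).length (rename φ) (t / φ.length) (t % φ.length))
  | 0 => by simp
  | K + 1 => by
    rw [ccat_succ, ccat_pieceF hφ hm K, List.range_succ, List.flatMap_append, List.flatMap_singleton, encList_append,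
      ← arg, pieceF_arg hφ hm]

/-- **Value of the incidence fold on a code**: the list code of `allItems φ` (unclipping by
`foldAcc_clip2F`). [folklore] -/
theorem tcodeF_encode {φ : CNF ℕ} (hφ : φ.IsThreeLiteralClauses) : tcodeF (encodingCNF.encode φ) = encList (allItems φ) := by
  have hn := length_varList hφ
  have hL : φ.length ≤ (encodingCNF.encode φ).length := by
    have := length_fstF_sndF_le (encodingCNF.encode φ)
    rw [encodeCNF_eq, fstF_boolPair, List.length_replicate] at this
    rw [encodeCNF_eq]; omega
  have hk : 2 * (varList φ).length * φ.length ≤ (Polynomial.C 6 * X ^ 2 : Polynomial ℕ).eval (encodingCNF.encode φ).length := by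
    simp only [eval_mul, eval_C, eval_pow, eval_X, hn]
    nlinarith [hL]
  have hinit : tInit (encodingCNF.encode φ) = boolPair (encodingCNF.encode φ)
      (boolPair (encodeNat (2 * (varList φ).length * φ.length)) (boolPair (ones 0) [])) := by
    simp only [tInit, fanoutFn_apply, id, Function.comp_apply, kF_encode hφ, lenBinF_apply, List.length_replicate]
  rw [tcodeF, Function.comp_apply, Function.comp_apply, hinit, foldLoop_apply _ _ hk, foldAcc_clip2F, foldAcc_appF,
    List.nil_append]
  · simp only [sndPow_succ_boolPair, sndPow_zero_boolPair, Nat.zero_add, allItems]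
    rcases Nat.eq_zero_or_pos φ.length with hm | hm
    · simp [hm]
    · exact ccat_pieceF hφ hm _
  · intro j _ hj
    rw [Nat.zero_add] at hj
    exact length_pieceF_arg hφ hj

/-- **The items are the coded incidences of the ladder complex.** [folklore] -/
theorem mem_allItems_iff {φ : CNF ℕ} {x : List Bool} :
    x ∈ allItems φ ↔ ∃ t ∈ T (varList φ).length (rename φ), x = encInc t := by
  simp only [allItems, List.mem_flatMap, List.mem_range, stageItems, List.mem_cons, List.not_mem_nil, or_false,
    mem_T_iff, length_rename]
  constructor
  · rintro ⟨t, ht, h⟩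
    have hm : 0 < φ.length := Nat.pos_of_ne_zero fun h0 => by rw [h0] at ht; simp at ht
    have hi : t / φ.length < 2 * (varList φ).length := (Nat.div_lt_iff_lt_mul hm).2 ht
    have hc : t % φ.length < φ.length := Nat.mod_lt _ hm
    rcases h with rfl | rfl | rfl | rfl
    · exact ⟨_, ⟨_, hi, _, hc, Or.inl rfl⟩, rfl⟩
    · exact ⟨_, ⟨_, hi, _, hc, Or.inr (Or.inl rfl)⟩, rfl⟩
    · exact ⟨_, ⟨_, hi, _, hc, Or.inr (Or.inr (Or.inl rfl))⟩, rfl⟩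
    · exact ⟨_, ⟨_, hi, _, hc, Or.inr (Or.inr (Or.inr rfl))⟩, rfl⟩
  · rintro ⟨t', ⟨i, hi, c, hc, h⟩, rfl⟩
    have hm : 0 < φ.length := by omega
    refine ⟨i * φ.length + c, ?_, ?_⟩
    · calc i * φ.length + c < i * φ.length + φ.length := by omega
        _ = (i + 1) * φ.length := by ring
        _ ≤ 2 * (varList φ).length * φ.length := Nat.mul_le_mul_right _ (by omega)
    · have e1 : (i * φ.length + c) / φ.length = i := by
        rw [Nat.add_comm, Nat.add_mul_div_right _ _ hm, Nat.div_eq_of_lt hc, Nat.zero_add]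
      have e2 : (i * φ.length + c) % φ.length = c := by
        rw [Nat.add_comm, Nat.add_mul_mod_self_right, Nat.mod_eq_of_lt hc]
      rw [e1, e2]
      rcases h with rfl | rfl | rfl | rfl
      · exact Or.inl rfl
      · exact Or.inr (Or.inl rfl)
      · exact Or.inr (Or.inr (Or.inl rfl))
      · exact Or.inr (Or.inr (Or.inr rfl))

end OneInThree

end Literature.Computability.Complexity
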